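import Summits.Langlands.Langlands.Theses.SteinbergVelocityDst
import Literature.NumberTheory.Automorphic.AdicCompletionCompact
import HarnessLib

/-!
# `SteinbergVelocityDst.SteinbergMechanism` — the Steinberg weight-velocity mechanism (Ding §3)

Item `stmt-Langlands-14051` of route `Langlands/SteinbergVelocityDst`:
`InfinitesimalWeightVelocity → NonSplitSteinbergGraded → StrictSteinbergGraded → MaximalMonodromyDst`, proved outright
(`steinbergMechanism`, Part 2), after three elementary lemmas on continuous additive characters `ψ : Fˣ → E`
(`HomCont F E`) of a valued field (Part 1, folklore):

* `gapDerivative_mem_homCont` — the gap derivative `ψ(δ̃ᵢ, δ̃ⱼ)` of first-order characters lifting `E`-valued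
  characters `δᵢ, δⱼ` is a continuous additive character (continuity needs no continuous inversion on `E`: the
  constant term of the ratio is the unit `δᵢ(x)δⱼ(x)⁻¹`);
* `apply_eq_zero_of_isLocallyConstant` — when `𝒪[F]` is compact and `E` has characteristic zero, a locally constant
  `ψ ∈ Hom(Fˣ, E)` vanishes on the units `{v(x) = 1}` (finite image of a compact group in a torsion-free group);
* `exists_eq_smul_of_apply_units_eq_zero` — for a `ℤ`-valued valuation, two additive characters vanishing on
  `{v(x) = 1}`, the second non-zero, are proportional (both factor through the value group `⊆ ℤ`).

**The mechanism.** In the shared context of the four statements (`K` CM, `π` regular algebraic cuspidal, `v ∣ p` in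
the sector, `π_v` of Steinberg type, an `E₀`-model `r_K` of `ρ`, a pinned package `𝔇.IsSteinbergVelocityPackage 𝓐 𝓒`,
and `D := (D_rig(r_K|K_v)).conj U` upper-triangular with parameters `𝓡(δ_j)`, cyclotomic, continuous, special,
semistable): `StrictSteinbergGraded` gives a strict triangulation, `NonSplitSteinbergGraded` the non-split graded
classes `c_i`, and Ding's Steinberg dictionary (`HasDingSteinbergDictionary`) reduces `N^{n-1} ≠ 0` to: no non-zero
locally constant `ψ ∈ Hom(K_vˣ, E₀)` has class in `𝓛(D)_i = c_i^⊥`.  Suppose one did.  The perfect pairing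
(`HasPerfectSpecialPairing`) gives `θ` with class outside `𝓛(D)_i`; `InfinitesimalWeightVelocity` writes `θ` on the
units as `Σ c_k ψ_i(δ̃_k)` for global first-order deformations `ρ̃_k`; the Colmez–Greenberg–Stevens formula
(`HasColmezGreenbergStevens`), applied to `D_rig` of `ρ̃_k|K_v` — a deformation of `D` by functoriality
(`IsFunctorial.drigOver_mem_deformationsOver`, `deformationsOver_congr`) — puts each `ψ_i(δ̃_k)` in `𝓛(D)_i`;
`θ - Σ c_k ψ_i(δ̃_k)` and the locally constant `ψ` both vanish on the units (`𝒪_v` is compact,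
`compactSpace_integer_adicCompletion`), hence are proportional, so the class of `θ` lies in the subspace `𝓛(D)_i` —
a contradiction.  [cite: Ding2019SimpleL, §3.1, Lemma 3.2, Thm. 3.4]
-/

set_option linter.dupNamespace false

namespace Summit.Langlands.Langlands.Theorems.SteinbergVelocityDstSteinbergMechanism

open Literature.NumberTheory.GaloisRepresentations Literature.NumberTheory.Automorphic
open Summit.Langlands.Langlands.Theses.SteinbergVelocityDst
open scoped Valued

/-! # Part 1. Continuous additive characters of a valued field -/

/-! ## Continuous additive characters: algebra -/

section HomContAlgebra

variable {F : Type*} [Field F] [TopologicalSpace F] {E : Type*} [Field E] [TopologicalSpace E]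
  [IsTopologicalRing E]

/-- An element of `Hom(Fˣ, E)` is additive: `ψ(ab) = ψ(a) + ψ(b)`. [folklore] -/
theorem homCont_map_mul (ψ : HomCont F E) (a b : Fˣ) :
    (ψ : Fˣ → E) (a * b) = (ψ : Fˣ → E) a + (ψ : Fˣ → E) b := ψ.2.2 a b

/-- An element of `Hom(Fˣ, E)` vanishes at `1`. [folklore] -/
theorem homCont_apply_one (ψ : HomCont F E) : (ψ : Fˣ → E) 1 = 0 := by
  have h := homCont_map_mul ψ 1 1
  rw [mul_one] at h
  simpa using h

/-- An element of `Hom(Fˣ, E)` is odd: `ψ(a⁻¹) = -ψ(a)`. [folklore] -/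
theorem homCont_apply_inv (ψ : HomCont F E) (a : Fˣ) : (ψ : Fˣ → E) a⁻¹ = -(ψ : Fˣ → E) a := by
  have h := homCont_map_mul ψ a a⁻¹
  rw [mul_inv_cancel, homCont_apply_one] at h
  linear_combination -h

/-- `ψ(aⁿ) = n ψ(a)` for natural `n`. [folklore] -/
theorem homCont_apply_pow (ψ : HomCont F E) (a : Fˣ) (n : ℕ) :
    (ψ : Fˣ → E) (a ^ n) = (n : E) * (ψ : Fˣ → E) a := by
  induction n with
  | zero => simp [homCont_apply_one]
  | succ n ih =>
    rw [pow_succ, homCont_map_mul, ih]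
    push_cast
    ring

/-- `ψ(aⁿ) = n ψ(a)` for integer `n`. [folklore] -/
theorem homCont_apply_zpow (ψ : HomCont F E) (a : Fˣ) (n : ℤ) :
    (ψ : Fˣ → E) (a ^ n) = (n : E) * (ψ : Fˣ → E) a := by
  obtain ⟨m, rfl | rfl⟩ := Int.eq_nat_or_neg n
  · rw [zpow_natCast, homCont_apply_pow, Int.cast_natCast]
  · rw [zpow_neg, zpow_natCast, homCont_apply_inv, homCont_apply_pow, Int.cast_neg, Int.cast_natCast,
      neg_mul]

/-- `ψ = 0` iff `ψ` vanishes everywhere. [folklore] -/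
theorem homCont_eq_zero_iff (ψ : HomCont F E) : ψ = 0 ↔ ∀ a : Fˣ, (ψ : Fˣ → E) a = 0 := by
  constructor
  · rintro rfl a
    rfl
  · intro h
    exact Subtype.ext (funext h)

end HomContAlgebra

/-! ## The gap derivative is a continuous additive character -/

section GapDerivative

variable {F : Type*} [Field F] [TopologicalSpace F] {E : Type*} [Field E] [TopologicalSpace E]
  [IsTopologicalRing E]

omit [TopologicalSpace E] [IsTopologicalRing E] in
/-- The constant term of the inverse of a unit of `E[ε]` is the inverse of its constant term. [folklore] -/
theorem fst_val_inv (u : (DualNumber E)ˣ) :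
    TrivSqZeroExt.fst ((u⁻¹ : (DualNumber E)ˣ) : DualNumber E) = (TrivSqZeroExt.fst (u : DualNumber E))⁻¹ := by
  have h : TrivSqZeroExt.fst ((u⁻¹ : (DualNumber E)ˣ) : DualNumber E) *
      TrivSqZeroExt.fst (u : DualNumber E) = 1 := by
    rw [← TrivSqZeroExt.fst_mul, ← Units.val_mul, inv_mul_cancel, Units.val_one, TrivSqZeroExt.fst_one]
  exact eq_inv_of_mul_eq_one_left h

omit [IsTopologicalRing E] in
/-- Under the lifting hypotheses `δ̃ᵢ ≡ δᵢ`, `δ̃ⱼ ≡ δⱼ (mod ε)`, the constant term of the ratio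
`δ̃ᵢ(x)δ̃ⱼ(x)⁻¹` is the unit `δᵢ(x)δⱼ(x)⁻¹` of `E`. [folklore] -/
theorem fst_ratio_eq (δi δj : Fˣ →ₜ* (DualNumber E)ˣ) (di dj : Fˣ →ₜ* Eˣ)
    (hi : ∀ x, TrivSqZeroExt.fst ((δi x : (DualNumber E)ˣ) : DualNumber E) = ((di x : Eˣ) : E))
    (hj : ∀ x, TrivSqZeroExt.fst ((δj x : (DualNumber E)ˣ) : DualNumber E) = ((dj x : Eˣ) : E)) (x : Fˣ) :
    TrivSqZeroExt.fst (((δi x : (DualNumber E)ˣ) : DualNumber E) * (((δj x)⁻¹ : (DualNumber E)ˣ) : DualNumber E)) =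
      ((di x * (dj x)⁻¹ : Eˣ) : E) := by
  rw [TrivSqZeroExt.fst_mul, fst_val_inv, hi, hj, Units.val_mul, Units.val_inv_eq_inv_val]

/-- **Continuity of the gap derivative** of first-order lifts `δ̃ᵢ, δ̃ⱼ` of continuous characters
`δᵢ, δⱼ : Fˣ → Eˣ`: `ψ(x) = snd(δ̃ᵢ(x)δ̃ⱼ(x)⁻¹) · (δᵢ(x)δⱼ(x)⁻¹)⁻¹`, a product of continuous functions
(the inverse is taken in the topological group `Eˣ`, so no continuity of inversion on `E` is needed). [folklore] -/
theorem continuous_gapDerivative (δi δj : Fˣ →ₜ* (DualNumber E)ˣ) (di dj : Fˣ →ₜ* Eˣ)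
    (hi : ∀ x, TrivSqZeroExt.fst ((δi x : (DualNumber E)ˣ) : DualNumber E) = ((di x : Eˣ) : E))
    (hj : ∀ x, TrivSqZeroExt.fst ((δj x : (DualNumber E)ˣ) : DualNumber E) = ((dj x : Eˣ) : E)) :
    Continuous (gapDerivative δi δj) := by
  have h1 : Continuous fun x : Fˣ =>
      ((δi x : (DualNumber E)ˣ) : DualNumber E) * (((δj x)⁻¹ : (DualNumber E)ˣ) : DualNumber E) :=
    (Units.continuous_val.comp (map_continuous δi)).mul (Units.continuous_coe_inv.comp (map_continuous δj))
  have h2 : Continuous fun x : Fˣ => (((di x * (dj x)⁻¹)⁻¹ : Eˣ) : E) :=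
    Units.continuous_coe_inv.comp ((map_continuous di).mul ((map_continuous dj).inv))
  have h3 : gapDerivative δi δj = fun x => TrivSqZeroExt.snd
      (((δi x : (DualNumber E)ˣ) : DualNumber E) * (((δj x)⁻¹ : (DualNumber E)ˣ) : DualNumber E)) *
        (((di x * (dj x)⁻¹)⁻¹ : Eˣ) : E) := by
    funext x
    rw [gapDerivative_apply, fst_ratio_eq δi δj di dj hi hj x, Units.val_inv_eq_inv_val]
  rw [h3]
  exact (TrivSqZeroExt.continuous_snd.comp h1).mul h2

/-- **The gap derivative is an element of `Hom(Fˣ, E)`** (continuous by `continuous_gapDerivative`,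
additive by `gapDerivative_mul`). [folklore] -/
theorem gapDerivative_mem_homCont (δi δj : Fˣ →ₜ* (DualNumber E)ˣ) (di dj : Fˣ →ₜ* Eˣ)
    (hi : ∀ x, TrivSqZeroExt.fst ((δi x : (DualNumber E)ˣ) : DualNumber E) = ((di x : Eˣ) : E))
    (hj : ∀ x, TrivSqZeroExt.fst ((δj x : (DualNumber E)ˣ) : DualNumber E) = ((dj x : Eˣ) : E)) :
    gapDerivative δi δj ∈ HomCont F E :=
  ⟨continuous_gapDerivative δi δj di dj hi hj, gapDerivative_mul δi δj⟩

end GapDerivative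

/-! ## Locally constant characters vanish on the units of a field with compact integers -/

section Unramified

variable {F : Type*} [Field F] {Γ₀ : Type*} [LinearOrderedCommGroupWithZero Γ₀] [Valued F Γ₀]
  {E : Type*} [Field E] [TopologicalSpace E] [IsTopologicalRing E]

/-- **A locally constant additive character vanishes on the units** `{v(x) = 1}` when `𝒪[F]` is compact and
`E` has characteristic zero: composed with the continuous map `𝒪[F]ˣ → Fˣ` it is a locally constant function on
a compact space, so has finite image; an additive map from a group with finite image into a torsion-free group
is zero (`n ↦ ψ(uⁿ) = n ψ(u)` would be injective). [folklore] -/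
theorem apply_eq_zero_of_isLocallyConstant [CompactSpace 𝒪[F]] [CharZero E] (ψ : HomCont F E)
    (hψ : IsLocallyConstant (ψ : Fˣ → E)) (x : Fˣ) (hx : Valued.v (x : F) = 1) : (ψ : Fˣ → E) x = 0 := by
  let ι : (𝒪[F])ˣ →* Fˣ := Units.map (𝒪[F].subtype : 𝒪[F] →* F)
  have hιc : Continuous ι := by
    refine Units.continuous_iff.2 ⟨?_, ?_⟩
    · exact continuous_subtype_val.comp Units.continuous_val
    · exact continuous_subtype_val.comp Units.continuous_coe_inv
  have hfin : (Set.range ((ψ : Fˣ → E) ∘ ι)).Finite := (hψ.comp_continuous hιc).range_finite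
  have hxO : (x : F) ∈ 𝒪[F] := (Valuation.mem_integer_iff _ _).2 hx.le
  have hxO' : ((x⁻¹ : Fˣ) : F) ∈ 𝒪[F] := (Valuation.mem_integer_iff _ _).2 (by
    rw [Units.val_inv_eq_inv_val, map_inv₀, hx, inv_one])
  let u : (𝒪[F])ˣ := ⟨⟨x, hxO⟩, ⟨((x⁻¹ : Fˣ) : F), hxO'⟩, Subtype.ext x.mul_inv, Subtype.ext x.inv_mul⟩
  have hu : ι u = x := Units.ext rfl
  by_contra hne
  have hinj : Function.Injective fun n : ℕ => ((ψ : Fˣ → E) ∘ ι) (u ^ n) := by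
    intro m m' hmm
    have hmm' : (ψ : Fˣ → E) (x ^ m) = (ψ : Fˣ → E) (x ^ m') := by
      simpa only [Function.comp_apply, map_pow, hu] using hmm
    rw [homCont_apply_pow, homCont_apply_pow] at hmm'
    exact Nat.cast_injective (mul_right_cancel₀ hne hmm')
  exact (Set.infinite_range_of_injective hinj).not_finite
    (hfin.subset (Set.range_subset_iff.2 fun n => ⟨u ^ n, rfl⟩))

end Unramified

/-! ## Characters vanishing on the units factor through the value group -/

section ValueGroup

variable {F : Type*} [Field F] [Valued F (WithZero (Multiplicative ℤ))]
  {E : Type*} [Field E] [TopologicalSpace E] [IsTopologicalRing E]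

/-- **Two additive characters vanishing on `{v(x) = 1}` are proportional** when the second is non-zero and the
valuation is `ℤ`-valued: with `a = log v(x)`, `b = log v(x₀) ≠ 0` the element `x^b x₀^{-a}` has valuation `1`,
so `b θ(x) = a θ(x₀)` and `b ψ(x) = a ψ(x₀)`, whence `θ(x) = (θ(x₀)/ψ(x₀)) ψ(x)` (`E` of characteristic
zero). [folklore] -/
theorem exists_eq_smul_of_apply_units_eq_zero [CharZero E] (θ ψ : HomCont F E)
    (hθ : ∀ x : Fˣ, Valued.v (x : F) = 1 → (θ : Fˣ → E) x = 0)
    (hψ : ∀ x : Fˣ, Valued.v (x : F) = 1 → (ψ : Fˣ → E) x = 0) (hne : ψ ≠ 0) :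
    ∃ c : E, θ = c • ψ := by
  obtain ⟨x₀, hx₀⟩ : ∃ x₀ : Fˣ, (ψ : Fˣ → E) x₀ ≠ 0 := by
    by_contra h
    push Not at h
    exact hne ((homCont_eq_zero_iff ψ).2 h)
  refine ⟨(θ : Fˣ → E) x₀ * ((ψ : Fˣ → E) x₀)⁻¹, Subtype.ext (funext fun x => ?_)⟩
  show (θ : Fˣ → E) x = ((θ : Fˣ → E) x₀ * ((ψ : Fˣ → E) x₀)⁻¹) • (ψ : Fˣ → E) x
  rw [smul_eq_mul]
  have hvx : Valued.v (x : F) ≠ 0 := (Valuation.ne_zero_iff _).2 x.ne_zero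
  have hvx₀ : Valued.v (x₀ : F) ≠ 0 := (Valuation.ne_zero_iff _).2 x₀.ne_zero
  have hb0 : WithZero.log (Valued.v (x₀ : F)) ≠ 0 := by
    intro hb0
    apply hx₀
    apply hψ
    rw [← WithZero.exp_log hvx₀, hb0, WithZero.exp_zero]
  -- the element of valuation one
  have hy : Valued.v ((x ^ WithZero.log (Valued.v (x₀ : F)) * x₀ ^ (-WithZero.log (Valued.v (x : F))) : Fˣ) : F)
      = 1 := by
    rw [Units.val_mul, Units.val_zpow_eq_zpow_val, Units.val_zpow_eq_zpow_val, map_mul, map_zpow₀, map_zpow₀]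
    have hne' : Valued.v (x : F) ^ WithZero.log (Valued.v (x₀ : F)) *
        Valued.v (x₀ : F) ^ (-WithZero.log (Valued.v (x : F))) ≠ 0 :=
      mul_ne_zero (zpow_ne_zero _ hvx) (zpow_ne_zero _ hvx₀)
    rw [← WithZero.exp_log hne', WithZero.log_mul (zpow_ne_zero _ hvx) (zpow_ne_zero _ hvx₀),
      WithZero.log_zpow, WithZero.log_zpow]
    have h0 : WithZero.log (Valued.v (x₀ : F)) • WithZero.log (Valued.v (x : F)) +
        -WithZero.log (Valued.v (x : F)) • WithZero.log (Valued.v (x₀ : F)) = 0 := by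
      simp only [smul_eq_mul]
      ring
    rw [h0, WithZero.exp_zero]
  have h1 := hθ _ hy
  have h2 := hψ _ hy
  rw [homCont_map_mul, homCont_apply_zpow, homCont_apply_zpow] at h1
  rw [homCont_map_mul, homCont_apply_zpow, homCont_apply_zpow] at h2
  push_cast at h1 h2
  have hbE : ((WithZero.log (Valued.v (x₀ : F)) : ℤ) : E) ≠ 0 := Int.cast_ne_zero.2 hb0
  set a : E := ((WithZero.log (Valued.v (x : F)) : ℤ) : E) with ha
  set b : E := ((WithZero.log (Valued.v (x₀ : F)) : ℤ) : E) with hb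
  have e1 : b * (θ : Fˣ → E) x = a * (θ : Fˣ → E) x₀ := by linear_combination h1
  have e2 : b * (ψ : Fˣ → E) x = a * (ψ : Fˣ → E) x₀ := by linear_combination h2
  refine mul_left_cancel₀ hbE ?_
  calc b * (θ : Fˣ → E) x = a * (θ : Fˣ → E) x₀ := e1
    _ = a * (θ : Fˣ → E) x₀ * (((ψ : Fˣ → E) x₀)⁻¹ * (ψ : Fˣ → E) x₀) := by
        rw [inv_mul_cancel₀ hx₀, mul_one]
    _ = (θ : Fˣ → E) x₀ * ((ψ : Fˣ → E) x₀)⁻¹ * (a * (ψ : Fˣ → E) x₀) := by ring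
    _ = (θ : Fˣ → E) x₀ * ((ψ : Fˣ → E) x₀)⁻¹ * (b * (ψ : Fˣ → E) x) := by rw [e2]
    _ = b * ((θ : Fˣ → E) x₀ * ((ψ : Fˣ → E) x₀)⁻¹ * (ψ : Fˣ → E) x) := by ring

end ValueGroup

/-! # Part 2. The mechanism -/

/-- **The Steinberg mechanism** (item `SteinbergVelocityDst.SteinbergMechanism`): infinitesimal weight velocity,
non-split graded classes and strictness of the special triangulation imply maximal monodromy `N^{n-1} ≠ 0` on
Berger's `D_st`, by Ding's dictionary, the perfect special pairing and the first-order Colmez–Greenberg–Stevens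
formula of the pinned package. [cite: Ding2019SimpleL, §3.1, Lemma 3.2, Thm. 3.4] -/
theorem steinbergMechanism : SteinbergMechanism := by
  intro hV hNS hST K _ _ _ n hcpt π hn hreg p _ ι ρ hss hsat v hv hbud hrec hjac E₀ _ _ _ _ _ emb hemb hembc rK
    hconj 𝔇 𝓐 𝓒 hP U δ h hcyc hcont hsp hsst
  have hST' := hST K n hcpt π hn hreg p ι ρ hss hsat v hv hbud hrec hjac E₀ emb hemb hembc rK hconj
    𝔇 𝓐 𝓒 hP U δ h hcyc hcont hsp hsst
  have hNS' := hNS K n hcpt π hn hreg p ι ρ hss hsat v hv hbud hrec hjac E₀ emb hemb hembc rK hconj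
    𝔇 𝓐 𝓒 hP U δ h hcyc hcont hsp hsst hST'
  have hV' := hV K n hcpt π hn hreg p ι ρ hss hsat v hv hbud hrec hjac E₀ emb hemb hembc rK hconj
    𝔇 𝓐 𝓒 hP U δ h hcyc hcont hsp hsst
  refine hP.hasDingSteinbergDictionary n hn _ _ hcyc hcont hsp hNS' hST' hsst ?_
  intro i hi ψ hlc hne hmem
  haveI : CharZero E₀ := charZero_of_injective_algebraMap (algebraMap ℚ_[p] E₀).injective
  haveI : CompactSpace 𝒪[v.adicCompletion K] := compactSpace_integer_adicCompletion K v
  -- the locally constant `ψ` vanishes on the units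
  have hψ0 : ∀ x : (v.adicCompletion K)ˣ, Valued.v (x : v.adicCompletion K) = 1 →
      (ψ : (v.adicCompletion K)ˣ → E₀) x = 0 :=
    fun x hx => apply_eq_zero_of_isLocallyConstant ψ hlc x hx
  -- `θ` with class outside `𝓛(D)_i`
  obtain ⟨θ, hθ⟩ := hP.hasPerfectSpecialPairing n _ _ i hi hcyc hcont (hsp i hi) (hNS' i hi)
  -- velocity: `θ = Σ c_k ψ_i(δ̃_k)` on the units
  obtain ⟨r, ρε, δε, Uε, c, hfst, hδfst, htri, hsum⟩ := hV' i hi θ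
  -- the gap derivatives are continuous additive characters
  have hmemk : ∀ k : Fin r,
      gapDerivative (δε k ⟨i, Nat.lt_of_succ_lt hi⟩) (δε k ⟨i + 1, hi⟩) ∈ HomCont (v.adicCompletion K) E₀ :=
    fun k => gapDerivative_mem_homCont _ _ (δ ⟨i, Nat.lt_of_succ_lt hi⟩) (δ ⟨i + 1, hi⟩)
      (fun x => hδfst k _ x) (fun x => hδfst k _ x)
  -- `D_rig(ρ̃_k|K_v)` is a first-order deformation of `D`
  have hDε : ∀ k : Fin r, 𝓐.drigOverDualNumber ((ρε k).toLocal v) ∈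
      𝔇.deformationsOver (DualNumber E₀) (TrivSqZeroExt.fstHom E₀ E₀ E₀) ((𝔇.Drig (rK.toLocal v)).conj U) := by
    intro k
    haveI := moduleFinite_dualNumber E₀
    haveI := isModuleTopology_dualNumber E₀
    have hmemρ : (ρε k).toLocal v ∈
        FramedGaloisRep.deformationsOver (DualNumber E₀) (TrivSqZeroExt.fstHom E₀ E₀ E₀) (rK.toLocal v) :=
      (FramedGaloisRep.mem_deformationsOver_dualNumber_iff (rK.toLocal v) ((ρε k).toLocal v)).2
        fun σ a b => hfst k _ a b
    rw [← 𝔇.deformationsOver_congr (DualNumber E₀) (TrivSqZeroExt.fstHom E₀ E₀ E₀)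
      (show (𝔇.Drig (rK.toLocal v)).IsIso ((𝔇.Drig (rK.toLocal v)).conj U) from ⟨U, rfl⟩)]
    exact PhiGammaModuleRobba.DrigArtinian.IsFunctorial.drigOver_mem_deformationsOver 𝓐 hP.isFunctorial
      (TrivSqZeroExt.fstHom E₀ E₀ E₀) hmemρ
  -- Colmez–Greenberg–Stevens: each `ψ_i(δ̃_k)` has class in `𝓛(D)_i`
  have hclassk : ∀ k : Fin r, 𝔇.H1toH1 (PhiGammaModule.unit 𝔇.ring)
      (𝔇.homToH1 ⟨_, hmemk k⟩) ∈
        ((PhiGammaModule.Triangulation.ofTriangular ((𝔇.Drig (rK.toLocal v)).conj U)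
          (fun j => 𝔇.ofChar (δ j)) h).ratioParam i hi).toModule.cupOrthogonal 𝔇.gen
          ((PhiGammaModule.Triangulation.ofTriangular ((𝔇.Drig (rK.toLocal v)).conj U)
            (fun j => 𝔇.ofChar (δ j)) h).gradedClass 𝔇.gen i hi) :=
    fun k => hP.hasColmezGreenbergStevens n ((𝔇.Drig (rK.toLocal v)).conj U) δ h hcyc hcont
      (fun j hj => ⟨hsp j hj, hNS' j hj⟩) (𝓐.drigOverDualNumber ((ρε k).toLocal v)) (hDε k) (δε k) (Uε k)
      (fun j x => hδfst k j x) (htri k) i hi ⟨_, hmemk k⟩ (fun x => rfl)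
  -- `θ - Σ c_k ψ_k` vanishes on the units
  obtain ⟨S, hS⟩ : ∃ S : HomCont (v.adicCompletion K) E₀,
      S = ∑ k : Fin r, c k • (⟨_, hmemk k⟩ : HomCont (v.adicCompletion K) E₀) := ⟨_, rfl⟩
  have hθ'0 : ∀ x : (v.adicCompletion K)ˣ, Valued.v (x : v.adicCompletion K) = 1 →
      ((θ - S : HomCont (v.adicCompletion K) E₀) : (v.adicCompletion K)ˣ → E₀) x = 0 := by
    intro x hx
    simp only [hS, Submodule.coe_sub, Submodule.coe_sum, Submodule.coe_smul, Pi.sub_apply,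
      Finset.sum_apply, Pi.smul_apply, smul_eq_mul, hsum x hx]
    exact sub_self _
  -- hence `θ - Σ c_k ψ_k = λ ψ`
  obtain ⟨lam, hlam⟩ := exists_eq_smul_of_apply_units_eq_zero (θ - S) ψ hθ'0 hψ0 hne
  have hθeq : θ = lam • ψ + S := by rw [← hlam, sub_add_cancel]
  -- and the class of `θ` is `λ [ψ] + Σ c_k [ψ_k] ∈ 𝓛(D)_i`: contradiction
  have hθcl : 𝔇.H1toH1 (PhiGammaModule.unit 𝔇.ring) (𝔇.homToH1 θ) =
      lam • 𝔇.H1toH1 (PhiGammaModule.unit 𝔇.ring) (𝔇.homToH1 ψ) +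
        ∑ k : Fin r, c k • 𝔇.H1toH1 (PhiGammaModule.unit 𝔇.ring) (𝔇.homToH1 ⟨_, hmemk k⟩) := by
    rw [hθeq, hS]
    simp only [map_add, map_smul, map_sum]
  apply hθ
  rw [hθcl]
  exact Submodule.add_mem _ (Submodule.smul_mem _ _ hmem)
    (Submodule.sum_mem _ fun k _ => Submodule.smul_mem _ _ (hclassk k))

end Summit.Langlands.Langlands.Theorems.SteinbergVelocityDstSteinbergMechanism
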